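import Mathlib
import Summits.ValiantsHypothesis.ValiantsHypothesis.Theorems.NewtonUnitEquationsNewtonTauWeakAutomatonGreedy

/-!
# `NewtonUnitEquationsNewtonTauWeakAutomatonBoxGreedy` — box automaton with general moduli: every Newton vertex is a
greedy position

Rung toward `stub_binomialNewtonTauCommon` (crux `NewtonTauWeak`, stmt-ValiantsHypothesis-5904), line
`binomial-normal-form`, lead c5, THEOREM C (mixed radix, carries in `{0, …, C}²`): registered stub `stub_boxGreedy`,
the generalisation of `stub_autoGreedyGen` (file `…NewtonTauWeakAutomatonGreedyGen.lean`, moduli `2^n, 2^n`) to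
arbitrary moduli `Mx, My` in the two coordinates.

Setting.  `f : MvPolynomial (Fin 2) ℂ` has all its exponents in the box `[0, Mx (C+1)) × [0, My (C+1))`, and its
coefficient ARRAY is a linear image of a vector configuration `x : E → ℂ^d` on the box `E = [0, Mx) × [0, My)`: for
every final state `t ∈ {0, …, C}²` and every `P ∈ E`, `coeff_{(Mx t₁ + P₁, My t₂ + P₂)} f = ℓ_t (x P)` for linear
functionals `ℓ_t`.

Claim `stub_boxGreedy`: `vert f ≤ (C+1)² · |cshadow E x|`, where `cshadow` (Theorem Q's configuration shadow, file
`…DissociatedUniformGreedyCharts.lean`) is the set of positions which are lex-greedy for some planar direction whose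
height is injective on `E`.

Proof (verbatim the proof of `stub_autoGreedyGen`, with `2^n` replaced by `Mx`, `My`).  A vertex `V` of the Newton
polygon is, by `stub_exposedGenericDirection`, the embedding of an exponent `v ∈ supp f` which is the STRICT maximiser
over `supp f` of a height `s ↦ ∑ i, w i * s i`, with `w` chosen so that this height is injective on the finite set `T`
of all exponents `(Mx t₁ + Q₁, My t₂ + Q₂)`, `t ∈ {0, …, C}²`, `Q ∈ E`.  Write `v = (Mx t₁ + P₁, My t₂ + P₂)`
(`t₁ = v₀ / Mx < C + 1`, `P₁ = v₀ % Mx < Mx`, and likewise in the second coordinate; `Mx, My > 0` because `v` lies in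
the box; `exists_digits_box`).  Then `P` is greedy for the direction `w`: the height of `(Mx t₁ + Q₁, My t₂ + Q₂)` is a
constant (depending on `t`) plus the planar height `lin w Q = w 0 * Q.1 + w 1 * Q.2`, so (i) `lin w` is injective on
`E` (injectivity on `T`), and (ii) for every `Q ∈ E` with `lin w P < lin w Q` the exponent `(Mx t₁ + Q₁, My t₂ + Q₂)`
is strictly higher than the strict maximiser `v`, hence not in `supp f`, i.e. `ℓ_t (x Q) = 0`: the functional `ℓ_t`
kills the span of these `x Q` (`AutoGreedyAux.not_mem_span_of_functional`) but `ℓ_t (x P) = coeff_v f ≠ 0`, so `x P`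
is not in that span.  Hence `P ∈ cshadow E x` and `V = emb v`: the vertex set lies in the image of
`{0, …, C}² × cshadow`, of size `(C+1)² · |cshadow|` (`Fintype.card_prod`, `Fintype.card_fin`).
[folklore: Theorem Q, "the top survivor is greedy"]
-/

set_option linter.dupNamespace false

noncomputable section

open scoped BigOperators
open MvPolynomial
open Summit.ValiantsHypothesis.ValiantsHypothesis.Theorems.NewtonTauWeak.Negative (vert)
open Summit.ValiantsHypothesis.ValiantsHypothesis.Theorems.NewtonUnitEquationsDissociatedUniform
  (stub_exposedGenericDirection)
open Summit.ValiantsHypothesis.ValiantsHypothesis.Theorems.NewtonUnitEquationsDissociatedUniform.QuasiPoly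
  (cshadow gE lin cshadow_finite)

namespace Summit.ValiantsHypothesis.ValiantsHypothesis.Theorems.NewtonTauWeakAutomaton

namespace BoxGreedyAux

open AutoGreedyAux in
/-- **Digits in a box with a bounded carry.**  Every exponent in the box `[0, Mx (C+1)) × [0, My (C+1))` is
`(Mx t₁ + P₁, My t₂ + P₂)` with a final state `t ∈ {0, …, C}²` and a position `P ∈ [0, Mx) × [0, My)` (division with
remainder by `Mx`, resp. `My`, which are positive because the box is nonempty: `t₁ = v₀ / Mx`, `P₁ = v₀ % Mx`).
[folklore] -/
theorem exists_digits_box (C Mx My : ℕ) (v : Fin 2 →₀ ℕ) (hv0 : v 0 < Mx * (C + 1)) (hv1 : v 1 < My * (C + 1)) :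
    ∃ (t : Fin (C + 1) × Fin (C + 1)) (P : ℕ × ℕ),
      Finsupp.single 0 (Mx * (t.1 : ℕ) + P.1) + Finsupp.single 1 (My * (t.2 : ℕ) + P.2) = v ∧
        P.1 < Mx ∧ P.2 < My := by
  -- adapted from NewtonUnitEquationsNewtonTauWeakAutomatonGreedyGen.lean (`exists_digits_gen`, moduli `2^n`)
  have hx : 0 < Mx := Nat.pos_of_ne_zero (by rintro rfl; simp at hv0)
  have hy : 0 < My := Nat.pos_of_ne_zero (by rintro rfl; simp at hv1)
  have hv0' : v 0 < (C + 1) * Mx := by rw [mul_comm]; exact hv0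
  have hv1' : v 1 < (C + 1) * My := by rw [mul_comm]; exact hv1
  refine ⟨(⟨v 0 / Mx, (Nat.div_lt_iff_lt_mul hx).2 hv0'⟩, ⟨v 1 / My, (Nat.div_lt_iff_lt_mul hy).2 hv1'⟩),
    (v 0 % Mx, v 1 % My), ?_, Nat.mod_lt _ hx, Nat.mod_lt _ hy⟩
  refine Finsupp.ext (Fin.forall_fin_two.2 ⟨?_, ?_⟩)
  · rw [single_add_single_apply_zero]; exact Nat.div_add_mod _ _
  · rw [single_add_single_apply_one]; exact Nat.div_add_mod _ _

end BoxGreedyAux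

open AutoGreedyAux BoxGreedyAux in
/-- **`stub_boxGreedy`** (crux `NewtonTauWeak`, line `binomial-normal-form`, Theorem C, box automaton with general
moduli — top survivors are greedy, abstract form).  If the exponents of `f` lie in `[0, Mx (C+1)) × [0, My (C+1))` and
the coefficient array of `f` is a linear image `coeff_{(Mx t₁ + P₁, My t₂ + P₂)} f = ℓ_t (x P)` (`t ∈ {0, …, C}²`,
`P ∈ E = [0, Mx) × [0, My)`) of a vector configuration `x` on the box, then every Newton vertex
`(Mx t₁ + P₁, My t₂ + P₂)` of `f` has `P` lex-greedy for a direction whose planar height is injective on `E` (`ℓ_t`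
kills the vectors of all strictly higher positions but not `x P`), so `vert f ≤ (C+1)² · |cshadow E x|`
(`stub_exposedGenericDirection` supplies the strictly exposing, generic direction; generalises `stub_autoGreedyGen`,
the case `Mx = My = 2^n`). [folklore: Theorem Q, part "top survivor is greedy"] -/
theorem stub_boxGreedy {d : ℕ} (C Mx My : ℕ) (E : Finset (ℕ × ℕ))
    (hE : E = Finset.range Mx ×ˢ Finset.range My)
    (f : MvPolynomial (Fin 2) ℂ) (x : ℕ × ℕ → Fin d → ℂ) (ℓ : Fin (C + 1) × Fin (C + 1) → (Fin d → ℂ) →ₗ[ℂ] ℂ)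
    (hsupp : ∀ e ∈ f.support, e 0 < Mx * (C + 1) ∧ e 1 < My * (C + 1))
    (hcoeff : ∀ t : Fin (C + 1) × Fin (C + 1), ∀ P ∈ E,
      coeff (Finsupp.single 0 (Mx * (t.1 : ℕ) + P.1) + Finsupp.single 1 (My * (t.2 : ℕ) + P.2)) f = ℓ t (x P)) :
    vert f ≤ (C + 1) * (C + 1) *
      (Summit.ValiantsHypothesis.ValiantsHypothesis.Theorems.NewtonUnitEquationsDissociatedUniform.QuasiPoly.cshadow
        E x (fun P => ((P.1 : ℕ) : ℝ)) (fun P => ((P.2 : ℕ) : ℝ))).ncard := by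
  classical
  -- adapted from NewtonUnitEquationsNewtonTauWeakAutomatonGreedyGen.lean (`stub_autoGreedyGen`, moduli `2^n`)
  -- the exponent `(Mx t₁ + P₁, My t₂ + P₂)`, kept opaque as `g t P`
  obtain ⟨g, hg⟩ : ∃ g : Fin (C + 1) × Fin (C + 1) → ℕ × ℕ → (Fin 2 →₀ ℕ), ∀ t P, g t P =
      Finsupp.single 0 (Mx * (t.1 : ℕ) + P.1) + Finsupp.single 1 (My * (t.2 : ℕ) + P.2) :=
    ⟨_, fun _ _ => rfl⟩
  have hg0 : ∀ t P, g t P 0 = Mx * (t.1 : ℕ) + P.1 := fun t P => by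
    rw [hg, single_add_single_apply_zero]
  have hg1 : ∀ t P, g t P 1 = My * (t.2 : ℕ) + P.2 := fun t P => by
    rw [hg, single_add_single_apply_one]
  -- for a fixed final state the position is determined by the exponent
  have hginj : ∀ t P Q, g t P = g t Q → P = Q := by
    intro t P Q h
    have h0 := DFunLike.congr_fun h 0
    have h1 := DFunLike.congr_fun h 1
    rw [hg0, hg0, add_right_inj] at h0
    rw [hg1, hg1, add_right_inj] at h1
    exact Prod.ext h0 h1
  -- the height of `(Mx t₁ + P₁, My t₂ + P₂)` is a constant depending on `t` plus the planar height of `P`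
  have hheight : ∀ (w : Fin 2 → ℝ) (t : Fin (C + 1) × Fin (C + 1)) (P : ℕ × ℕ),
      ∑ i, w i * ((g t P i : ℕ) : ℝ) =
      (w 0 * ((Mx * (t.1 : ℕ) : ℕ) : ℝ) + w 1 * ((My * (t.2 : ℕ) : ℕ) : ℝ)) +
        lin (fun P : ℕ × ℕ => ((P.1 : ℕ) : ℝ)) (fun P : ℕ × ℕ => ((P.2 : ℕ) : ℝ)) w P := by
    intro w t P
    simp only [Fin.sum_univ_two, hg0, hg1, lin, Nat.cast_add]
    ring
  have hcoeff' : ∀ t, ∀ P ∈ E, coeff (g t P) f = ℓ t (x P) := fun t P hP => by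
    rw [hg]; exact hcoeff t P hP
  -- digits (with a carry in `{0, …, C}`) of a support exponent
  have hdigits : ∀ v ∈ f.support, ∃ t P, g t P = v ∧ P ∈ E := by
    intro v hv
    obtain ⟨t, P, h, hP1, hP2⟩ := exists_digits_box C Mx My v (hsupp v hv).1 (hsupp v hv).2
    refine ⟨t, P, by rw [hg]; exact h, ?_⟩
    rw [hE, Finset.mem_product, Finset.mem_range, Finset.mem_range]
    exact ⟨hP1, hP2⟩
  obtain ⟨S, hS⟩ :=
    (cshadow_finite E x (fun P : ℕ × ℕ => ((P.1 : ℕ) : ℝ)) (fun P : ℕ × ℕ => ((P.2 : ℕ) : ℝ))).exists_finset_coe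
  -- every vertex is the embedding of `(Mx t₁ + P₁, My t₂ + P₂)` with `P` in the configuration shadow
  have hsub : Set.extremePoints ℝ (convexHull ℝ ((fun e : Fin 2 →₀ ℕ => fun i : Fin 2 => ((e i : ℕ) : ℝ)) ''
      (f.support : Set (Fin 2 →₀ ℕ)))) ⊆
      (fun q : (Fin (C + 1) × Fin (C + 1)) × (ℕ × ℕ) => fun i : Fin 2 => ((g q.1 q.2 i : ℕ) : ℝ)) ''
        ((Finset.univ ×ˢ S : Finset ((Fin (C + 1) × Fin (C + 1)) × (ℕ × ℕ))) :
          Set ((Fin (C + 1) × Fin (C + 1)) × (ℕ × ℕ))) := by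
    intro V hV
    -- a strictly exposing direction, generic for all exponents `(Mx t₁ + Q₁, My t₂ + Q₂)`, `Q ∈ E`
    obtain ⟨w, v, hv, hVe, hmax, hinjT⟩ := stub_exposedGenericDirection f.support
      ((Finset.univ ×ˢ E).image fun q : (Fin (C + 1) × Fin (C + 1)) × (ℕ × ℕ) => g q.1 q.2) V hV
    obtain ⟨t, P, hvP, hPE⟩ := hdigits v hv
    have hT : ∀ Q ∈ E, g t Q ∈
        (((Finset.univ ×ˢ E).image fun q : (Fin (C + 1) × Fin (C + 1)) × (ℕ × ℕ) => g q.1 q.2 : Finset _) :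
          Set (Fin 2 →₀ ℕ)) := fun Q hQ =>
      Finset.mem_coe.mpr (Finset.mem_image.mpr ⟨(t, Q), Finset.mem_product.mpr ⟨Finset.mem_univ _, hQ⟩, rfl⟩)
    -- (i) the planar height is injective on `E`
    have hinjE : Set.InjOn (lin (fun P : ℕ × ℕ => ((P.1 : ℕ) : ℝ)) (fun P : ℕ × ℕ => ((P.2 : ℕ) : ℝ)) w) E := by
      intro Q₁ hQ₁ Q₂ hQ₂ heq
      refine hginj t Q₁ Q₂ (hinjT (hT Q₁ hQ₁) (hT Q₂ hQ₂) ?_)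
      show ∑ i, w i * ((g t Q₁ i : ℕ) : ℝ) = ∑ i, w i * ((g t Q₂ i : ℕ) : ℝ)
      rw [hheight, hheight, heq]
    -- (ii) `P` is greedy: `ℓ t` kills the strictly higher vectors but not `x P`
    have hgE : P ∈ gE E x (lin (fun P : ℕ × ℕ => ((P.1 : ℕ) : ℝ)) (fun P : ℕ × ℕ => ((P.2 : ℕ) : ℝ)) w) := by
      refine ⟨hPE, not_mem_span_of_functional (ℓ t) ?_ ?_⟩
      · rintro _ ⟨Q, ⟨hQE, hlt⟩, rfl⟩
        rw [← hcoeff' t Q hQE, ← notMem_support_iff]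
        intro hQsupp
        have hgt : ∑ i, w i * ((v i : ℕ) : ℝ) < ∑ i, w i * ((g t Q i : ℕ) : ℝ) := by
          rw [← hvP, hheight, hheight]
          linarith
        by_cases hne : g t Q = v
        · rw [hne] at hgt
          exact lt_irrefl _ hgt
        · exact lt_asymm hgt (hmax _ hQsupp hne)
      · rw [← hcoeff' t P hPE, hvP]
        exact mem_support_iff.mp hv
    have hPS : P ∈ S := by
      rw [← Finset.mem_coe, hS]
      exact ⟨w, hinjE, hgE⟩
    refine ⟨(t, P), Finset.mem_coe.mpr (Finset.mem_product.mpr ⟨Finset.mem_univ _, hPS⟩), ?_⟩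
    show (fun i : Fin 2 => ((g t P i : ℕ) : ℝ)) = V
    rw [hvP]
    exact hVe
  calc vert f = (Set.extremePoints ℝ (convexHull ℝ ((fun e : Fin 2 →₀ ℕ => fun i : Fin 2 => ((e i : ℕ) : ℝ)) ''
      (f.support : Set (Fin 2 →₀ ℕ))))).ncard := rfl
    _ ≤ ((fun q : (Fin (C + 1) × Fin (C + 1)) × (ℕ × ℕ) => fun i : Fin 2 => ((g q.1 q.2 i : ℕ) : ℝ)) ''
        ((Finset.univ ×ˢ S : Finset ((Fin (C + 1) × Fin (C + 1)) × (ℕ × ℕ))) :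
          Set ((Fin (C + 1) × Fin (C + 1)) × (ℕ × ℕ)))).ncard :=
        Set.ncard_le_ncard hsub ((Finset.finite_toSet _).image _)
    _ ≤ ((Finset.univ ×ˢ S : Finset ((Fin (C + 1) × Fin (C + 1)) × (ℕ × ℕ))) :
          Set ((Fin (C + 1) × Fin (C + 1)) × (ℕ × ℕ))).ncard :=
        Set.ncard_image_le (Finset.finite_toSet _)
    _ = (C + 1) * (C + 1) *
          (cshadow E x (fun P : ℕ × ℕ => ((P.1 : ℕ) : ℝ)) (fun P : ℕ × ℕ => ((P.2 : ℕ) : ℝ))).ncard := by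
        rw [Set.ncard_coe_finset, Finset.card_product, Finset.card_univ, ← hS, Set.ncard_coe_finset,
          Fintype.card_prod, Fintype.card_fin]

end Summit.ValiantsHypothesis.ValiantsHypothesis.Theorems.NewtonTauWeakAutomaton

end
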